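/-
Internal research formalisation (H21 Literature anchor). Source text: internal-research-only.
-/
import Mathlib
import HarnessLib

/-!
# Newton's interpolation formula and divided differences (Knuth, TAOCP vol. 2, §4.6.4)

Source: D. E. Knuth, *The Art of Computer Programming, vol. 2: Seminumerical Algorithms*,
§4.6.4 "Evaluation of polynomials", the paragraphs on interpolation [cite: KnuthTAOCP2, §4.6.4]:
Lagrange's formula (14), Newton's interpolation formula (15), its Horner-like evaluation
scheme (16), the divided-difference tableau (17) and exercise 15 (the `α`'s of (15) are the
divided differences).  Statements are quoted from the held text
`book:addison-wesleynd-art-computer-programming-volume-2-seminumerical-algorithms`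
(PDF pp. 449–451); locators are the book's own equation / exercise numbers.

Topic `Literature/Algebra/Polynomial`, namespace
`Literature.Algebra.Polynomial.NewtonInterpolation`.
Everything here is PROVED over an arbitrary field `F` (no named facts).

Setting.  Nodes `v : ℕ → F` and values `r : ℕ → F`; the interpolation polynomial through the
nodes `x_i, …, x_{i+k}` is Mathlib's `Lagrange.interpolate (Finset.Icc i (i + k)) v r`
(Knuth's `u^{[k]}` when `i = 0`, formula (14)).  Following exercise 15 we *define* the divided
difference `divDiff v r i k` (Knuth's tableau entry `y^{(k)}_{i+k}`, classically written
`f[x_i, …, x_{i+k}]`) as the coefficient of `x^k` in that interpolation polynomial, i.e. as the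
constant `α_k` of (15), and we PROVE the tableau recurrence (17)
`y^{(k+1)} = (y^{(k)}_{i+1…} - y^{(k)}_{i…}) / (x_{i+k+1} - x_i)` from the Neville–Aitken
splitting of the interpolant (Mathlib `Lagrange.interpolate_eq_add_interpolate_erase`).

Main results:
* `divDiff_zero`, `divDiff_succ` — the tableau (17): `α_0 = y_0` and the divided-difference
  recurrence (exercise 15);
* `newton_formula` — Newton's interpolation formula (15):
  `u^{[n]} = Σ_{k ≤ n} α_k (x - x_0) ⋯ (x - x_{k-1})`, with `α_k = divDiff v r 0 k`
  independent of the later nodes, as the text stresses;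
* `eval_newton_formula_node` — consequently the Newton sum takes the value `y_m` at `x_m`;
* `newtonHorner`, `newtonHorner_eq_eval` — the generalized Horner scheme (16) evaluates the
  Newton sum with `n` multiplications;
* `example_factorials` — the worked example of the text: interpolating `0!, 1!, 2!, 3!` by a
  cubic gives `u^{[3]}(x) = x(x-1)(x-2)/3 + x(x-1)/2 + 1` and the estimate `u^{[3]}(3/2) = 1.25`.
-/

open Polynomial Finset

namespace Literature.Algebra.Polynomial.NewtonInterpolation

variable {F : Type*} [Field F]

/-! ## Interval bookkeeping for the node sets `{i, …, i+k}` -/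

/-- The node index set `{i, …, i + k}` has `k + 1` elements. [cite: KnuthTAOCP2, §4.6.4 (14)] -/
theorem card_Icc_add (i k : ℕ) : #(Icc i (i + k)) = k + 1 := by
  rw [Nat.card_Icc]; omega

/-- Removing the last node `i + k + 1` from `{i, …, i+k+1}` leaves `{i, …, i+k}`.
[cite: KnuthTAOCP2, §4.6.4 (17)] -/
theorem Icc_erase_last (i k : ℕ) : (Icc i (i + k + 1)).erase (i + k + 1) = Icc i (i + k) := by
  rw [Finset.Icc_erase_right, Finset.Ico_add_one_right_eq_Icc]

/-- Removing the first node `i` from `{i, …, i+k+1}` leaves `{i+1, …, (i+1)+k}`.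
[cite: KnuthTAOCP2, §4.6.4 (17)] -/
theorem Icc_erase_first (i k : ℕ) :
    (Icc i (i + k + 1)).erase i = Icc (i + 1) (i + 1 + k) := by
  rw [Finset.Icc_erase_left, ← Finset.Icc_add_one_left_eq_Ioc, Nat.add_right_comm]

/-! ## Divided differences as leading coefficients (exercise 15) -/

/-- The divided difference `f[x_i, …, x_{i+k}]` (Knuth's tableau entry `y^{(k)}_{i+k}` of (17)),
DEFINED — following exercise 15 — as the coefficient `α_k` of `x^k` in the interpolation
polynomial of degree `≤ k` through the nodes `x_i, …, x_{i+k}` with values `y_i, …, y_{i+k}`.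
[cite: KnuthTAOCP2, §4.6.4 (17) and exercise 15] -/
noncomputable def divDiff (v r : ℕ → F) (i k : ℕ) : F :=
  (Lagrange.interpolate (Icc i (i + k)) v r).coeff k

/-- Unfolding lemma for `divDiff`. [cite: KnuthTAOCP2, §4.6.4 exercise 15] -/
theorem divDiff_def (v r : ℕ → F) (i k : ℕ) :
    divDiff v r i k = (Lagrange.interpolate (Icc i (i + k)) v r).coeff k := rfl

/-- The interpolant through `k + 1` distinct nodes has degree `< k + 1`.
[cite: KnuthTAOCP2, §4.6.4 (14)] -/
theorem degree_interpolate_Icc_lt (v r : ℕ → F) (i k : ℕ)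
    (hv : Set.InjOn v (Icc i (i + k) : Finset ℕ)) :
    (Lagrange.interpolate (Icc i (i + k)) v r).degree < (k + 1 : ℕ) := by
  have h := Lagrange.degree_interpolate_lt r hv
  rwa [card_Icc_add] at h

/-- Coefficients of the interpolant above its degree bound vanish: the coefficient of
`x^m`, `m > k`, of the interpolant through `x_i, …, x_{i+k}` is `0`.
[cite: KnuthTAOCP2, §4.6.4 (14)] -/
theorem coeff_interpolate_Icc_eq_zero (v r : ℕ → F) (i k : ℕ)
    (hv : Set.InjOn v (Icc i (i + k) : Finset ℕ)) {m : ℕ} (hm : k < m) :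
    (Lagrange.interpolate (Icc i (i + k)) v r).coeff m = 0 := by
  apply coeff_eq_zero_of_degree_lt
  exact (degree_interpolate_Icc_lt v r i k hv).trans_le (by exact_mod_cast hm)

/-- First column of the tableau (17): `f[x_i] = y_i`, i.e. `α_0 = y_0`.
[cite: KnuthTAOCP2, §4.6.4 (17) and exercise 15] -/
theorem divDiff_zero (v r : ℕ → F) (i : ℕ) : divDiff v r i 0 = r i := by
  rw [divDiff_def, Nat.add_zero, Finset.Icc_self, Lagrange.interpolate_singleton, coeff_C_zero]

/-- Coefficient bookkeeping for the Neville–Aitken splitting: if `deg p ≤ k` then the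
coefficient of `x^{k+1}` in `p · (c · (x - y))` is `c · [x^k] p`.
[cite: KnuthTAOCP2, §4.6.4 (17)] -/
theorem coeff_mul_basisDivisor_succ (p : F[X]) (x y : F) (k : ℕ)
    (hp : p.coeff (k + 1) = 0) :
    (p * Lagrange.basisDivisor x y).coeff (k + 1) = (x - y)⁻¹ * p.coeff k := by
  rw [Lagrange.basisDivisor, ← mul_assoc, mul_sub, coeff_sub, coeff_mul_X, coeff_mul_C,
    coeff_mul_C, coeff_mul_C, hp, zero_mul, zero_mul, sub_zero, mul_comm]

/-- THE DIVIDED-DIFFERENCE RECURRENCE (tableau (17), exercise 15): for distinct nodes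
`x_i, …, x_{i+k+1}`,
`f[x_i, …, x_{i+k+1}] = (f[x_{i+1}, …, x_{i+k+1}] - f[x_i, …, x_{i+k}]) / (x_{i+k+1} - x_i)`.
Proof: the Neville–Aitken splitting of the interpolant on `{i, …, i+k+1}` along its first and
last node (Mathlib `Lagrange.interpolate_eq_add_interpolate_erase`), read off at the
coefficient of `x^{k+1}`. [cite: KnuthTAOCP2, §4.6.4 (17) and exercise 15] -/
theorem divDiff_succ (v r : ℕ → F) (i k : ℕ)
    (hv : Set.InjOn v (Icc i (i + k + 1) : Finset ℕ)) :
    divDiff v r i (k + 1) =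
      (divDiff v r (i + 1) k - divDiff v r i k) / (v (i + k + 1) - v i) := by
  have hi : i ∈ Icc i (i + k + 1) := mem_Icc.mpr ⟨le_rfl, by omega⟩
  have hj : i + k + 1 ∈ Icc i (i + k + 1) := mem_Icc.mpr ⟨by omega, le_rfl⟩
  have hij : i ≠ i + k + 1 := by omega
  have hvL : Set.InjOn v (Icc i (i + k) : Finset ℕ) :=
    hv.mono (by rw [← Icc_erase_last]; exact coe_subset.mpr (erase_subset _ _))
  have hvR : Set.InjOn v (Icc (i + 1) (i + 1 + k) : Finset ℕ) :=
    hv.mono (by rw [← Icc_erase_first]; exact coe_subset.mpr (erase_subset _ _))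
  rw [divDiff_def, ← Nat.add_assoc,
    Lagrange.interpolate_eq_add_interpolate_erase r hv hi hj hij, Icc_erase_last,
    Icc_erase_first, coeff_add,
    coeff_mul_basisDivisor_succ _ _ _ _
      (coeff_interpolate_Icc_eq_zero v r i k hvL k.lt_succ_self),
    coeff_mul_basisDivisor_succ _ _ _ _
      (coeff_interpolate_Icc_eq_zero v r (i + 1) k hvR k.lt_succ_self),
    ← divDiff_def, ← divDiff_def]
  have hne : v (i + k + 1) - v i ≠ 0 := by
    intro h
    exact hij (hv (mem_coe.mpr hi) (mem_coe.mpr hj) (sub_eq_zero.mp h).symm)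
  have hne' : v i - v (i + k + 1) ≠ 0 := fun h => hne (by rw [← neg_sub, h, neg_zero])
  field_simp
  ring

/-- The second column of the tableau, spelled out:
`f[x_i, x_{i+1}] = (y_{i+1} - y_i)/(x_{i+1} - x_i)`.
[cite: KnuthTAOCP2, §4.6.4 (17)] -/
theorem divDiff_one (v r : ℕ → F) (i : ℕ) (hv : v i ≠ v (i + 1)) :
    divDiff v r i 1 = (r (i + 1) - r i) / (v (i + 1) - v i) := by
  have hinj : Set.InjOn v (Icc i (i + 0 + 1) : Finset ℕ) := by
    intro a ha b hb hab
    simp only [Nat.add_zero, coe_Icc, Set.mem_Icc] at ha hb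
    by_contra hne
    have key : (a = i ∧ b = i + 1) ∨ (a = i + 1 ∧ b = i) := by omega
    rcases key with ⟨rfl, rfl⟩ | ⟨rfl, rfl⟩
    · exact hv hab
    · exact hv hab.symm
  have h := divDiff_succ v r i 0 hinj
  simpa [divDiff_zero] using h

/-! ## Newton's interpolation formula (15) -/

/-- The Newton basis polynomial `(x - x_0)(x - x_1)⋯(x - x_{k-1})` is Mathlib's nodal polynomial
of the first `k` nodes; it is monic of degree `k`. [cite: KnuthTAOCP2, §4.6.4 (15)] -/
theorem natDegree_nodal_range (v : ℕ → F) (k : ℕ) :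
    (Lagrange.nodal (range k) v).natDegree = k := by
  rw [Lagrange.natDegree_nodal, card_range]

/-- The Newton basis polynomial of the first `k` nodes vanishes at each of those nodes.
[cite: KnuthTAOCP2, §4.6.4 (15)] -/
theorem eval_nodal_range_node (v : ℕ → F) {k m : ℕ} (hm : m < k) :
    (Lagrange.nodal (range k) v).eval (v m) = 0 :=
  Lagrange.eval_nodal_at_node (mem_range.mpr hm)

/-- The Newton sum `Σ_{k ≤ n} α_k (x - x_0)⋯(x - x_{k-1})` with `α_k = f[x_0, …, x_k]`.
[cite: KnuthTAOCP2, §4.6.4 (15)] -/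
noncomputable def newtonInterpolant (v r : ℕ → F) (n : ℕ) : F[X] :=
  ∑ k ∈ range (n + 1), C (divDiff v r 0 k) * Lagrange.nodal (range k) v

/-- Unfolding lemma for `newtonInterpolant`. [cite: KnuthTAOCP2, §4.6.4 (15)] -/
theorem newtonInterpolant_def (v r : ℕ → F) (n : ℕ) :
    newtonInterpolant v r n =
      ∑ k ∈ range (n + 1), C (divDiff v r 0 k) * Lagrange.nodal (range k) v :=
  rfl

/-- The Newton sum grows by one term: `N_{n+1} = N_n + α_{n+1} (x - x_0)⋯(x - x_n)` — the
text's observation that formula (15) "holds for all `n`; `α_k` does not depend on `x_{k+1}, …`".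
[cite: KnuthTAOCP2, §4.6.4 (15)] -/
theorem newtonInterpolant_succ (v r : ℕ → F) (n : ℕ) :
    newtonInterpolant v r (n + 1) =
      newtonInterpolant v r n + C (divDiff v r 0 (n + 1)) * Lagrange.nodal (range (n + 1)) v := by
  rw [newtonInterpolant_def, sum_range_succ, ← newtonInterpolant_def]

/-- The Newton sum `N_n` has degree `≤ n`. [cite: KnuthTAOCP2, §4.6.4 (15)] -/
theorem degree_newtonInterpolant_le (v r : ℕ → F) (n : ℕ) :
    (newtonInterpolant v r n).degree ≤ n := by
  rw [newtonInterpolant_def]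
  refine (degree_sum_le _ _).trans (Finset.sup_le fun k hk => ?_)
  refine (degree_mul_le _ _).trans ?_
  refine (add_le_add degree_C_le
    (degree_le_of_natDegree_le (natDegree_nodal_range v k).le)).trans ?_
  rw [zero_add]
  exact_mod_cast Nat.lt_succ_iff.mp (mem_range.mp hk)

/-- NEWTON'S INTERPOLATION FORMULA (15): for distinct nodes `x_0, …, x_n` the interpolation
polynomial `u^{[n]}` of (14) equals `α_n (x-x_0)⋯(x-x_{n-1}) + ⋯ + α_1 (x - x_0) + α_0` with
`α_k = f[x_0, …, x_k]` the divided differences.  Proof as in the text: `u^{[n+1]} - u^{[n]}`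
vanishes at `x_0, …, x_n`, so after subtracting `α_{n+1} (x-x_0)⋯(x-x_n)` (which kills the
coefficient of `x^{n+1}`) a polynomial of degree `≤ n` with `n + 1` roots remains, hence zero.
[cite: KnuthTAOCP2, §4.6.4 (15) and exercise 15] -/
theorem newton_formula (v r : ℕ → F) (n : ℕ) (hv : Set.InjOn v (Icc 0 n : Finset ℕ)) :
    Lagrange.interpolate (Icc 0 n) v r = newtonInterpolant v r n := by
  induction n with
  | zero =>
    rw [newtonInterpolant_def, zero_add, sum_range_one, range_zero, Lagrange.nodal_empty, mul_one,
      divDiff_zero, Finset.Icc_self, Lagrange.interpolate_singleton]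
  | succ n ih =>
    have hv' : Set.InjOn v (Icc 0 n : Finset ℕ) :=
      hv.mono (coe_subset.mpr (Icc_subset_Icc_right n.le_succ))
    have ih' := ih hv'
    -- `d := u^{[n+1]} - u^{[n]} - α_{n+1} · nodal` has degree `< n + 1` and `n + 1` roots.
    set d := Lagrange.interpolate (Icc 0 (n + 1)) v r - newtonInterpolant v r (n + 1) with hd
    have hdeg : d.degree < #(Icc 0 n) := by
      rw [Nat.card_Icc, Nat.sub_zero, Nat.cast_withBot]
      refine lt_of_le_of_lt ((degree_le_iff_coeff_zero _ _).mpr fun m hm => ?_)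
        (WithBot.coe_lt_coe.mpr n.lt_succ_self)
      have hm' : n < m := WithBot.coe_lt_coe.mp hm
      rw [hd, newtonInterpolant_succ, ← ih', coeff_sub, coeff_add, coeff_C_mul]
      have h0n : (0 : ℕ) + n = n := Nat.zero_add n
      have h0n1 : (0 : ℕ) + (n + 1) = n + 1 := Nat.zero_add _
      have hA : (Lagrange.interpolate (Icc 0 n) v r).coeff m = 0 := by
        have := coeff_interpolate_Icc_eq_zero v r 0 n (by rwa [h0n]) hm'
        rwa [h0n] at this
      rcases Nat.eq_or_lt_of_le (Nat.succ_le_of_lt hm') with rfl | hlt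
      · -- `m = n + 1`: the leading coefficients cancel
        have hB : (Lagrange.interpolate (Icc 0 (n + 1)) v r).coeff (n + 1) =
            divDiff v r 0 (n + 1) := by rw [divDiff_def, h0n1]
        have hC : (Lagrange.nodal (range (n + 1)) v).coeff (n + 1) = 1 := by
          have h := (Lagrange.nodal_monic (s := range (n + 1)) (v := v)).coeff_natDegree
          rwa [natDegree_nodal_range] at h
        rw [hA, hB, hC, zero_add, mul_one, sub_self]
      · -- `m > n + 1`: everything vanishes
        have hB : (Lagrange.interpolate (Icc 0 (n + 1)) v r).coeff m = 0 := by
          have := coeff_interpolate_Icc_eq_zero v r 0 (n + 1) (by rwa [h0n1]) hlt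
          rwa [h0n1] at this
        have hC : (Lagrange.nodal (range (n + 1)) v).coeff m = 0 := by
          apply coeff_eq_zero_of_natDegree_lt
          rw [natDegree_nodal_range]; exact hlt
        rw [hA, hB, hC, mul_zero, zero_add, sub_self]
    have hroots : ∀ m ∈ Icc 0 n, d.eval (v m) = 0 := by
      intro m hm
      have hmn : m < n + 1 := Nat.lt_succ_of_le (mem_Icc.mp hm).2
      have hm1 : m ∈ Icc 0 (n + 1) := mem_Icc.mpr ⟨Nat.zero_le _, hmn.le⟩
      rw [hd, eval_sub, newtonInterpolant_succ, ← ih', eval_add, eval_mul, eval_C,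
        eval_nodal_range_node v hmn, mul_zero, add_zero,
        Lagrange.eval_interpolate_at_node r hv hm1, Lagrange.eval_interpolate_at_node r hv' hm,
        sub_self]
    have hd0 : d = 0 := eq_zero_of_degree_lt_of_eval_index_eq_zero _ hv' hdeg hroots
    exact sub_eq_zero.mp hd0

/-- Newton's formula (15) with the node set written as `range (n + 1) = {0, …, n}`.
[cite: KnuthTAOCP2, §4.6.4 (15)] -/
theorem newton_formula_range (v r : ℕ → F) (n : ℕ)
    (hv : Set.InjOn v (range (n + 1) : Finset ℕ)) :
    Lagrange.interpolate (range (n + 1)) v r = newtonInterpolant v r n := by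
  rw [Nat.range_succ_eq_Icc_zero] at hv ⊢
  exact newton_formula v r n hv

/-- The Newton sum interpolates: `N_n(x_m) = y_m` for `m ≤ n` (formula (15) takes on the values
(14) is built from). [cite: KnuthTAOCP2, §4.6.4 (14)–(15)] -/
theorem eval_newtonInterpolant_node (v r : ℕ → F) (n : ℕ) (hv : Set.InjOn v (Icc 0 n : Finset ℕ))
    {m : ℕ} (hm : m ≤ n) : (newtonInterpolant v r n).eval (v m) = r m := by
  rw [← newton_formula v r n hv]
  exact Lagrange.eval_interpolate_at_node r hv (mem_Icc.mpr ⟨Nat.zero_le _, hm⟩)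

/-- Uniqueness side of (14)/(15): any polynomial of degree `≤ n` taking the values
`y_0, …, y_n` at the distinct nodes `x_0, …, x_n` IS the Newton sum.
[cite: KnuthTAOCP2, §4.6.4 (14)–(15)] -/
theorem eq_newtonInterpolant_of_eval_eq (v r : ℕ → F) (n : ℕ)
    (hv : Set.InjOn v (Icc 0 n : Finset ℕ)) {f : F[X]} (hf : f.degree < (n + 1 : ℕ))
    (hfr : ∀ m ≤ n, f.eval (v m) = r m) :
    f = newtonInterpolant v r n := by
  rw [← newton_formula v r n hv]
  refine Lagrange.eq_interpolate_of_eval_eq r hv ?_ fun m hm => hfr m (mem_Icc.mp hm).2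
  rwa [Nat.card_Icc, Nat.sub_zero]

/-! ## The generalized Horner scheme (16) -/

/-- The generalized Horner scheme (16), innermost bracket first: `newtonHorner v α x k m`
evaluates the tail `α_k + (x - x_k)(α_{k+1} + (x - x_{k+1})(⋯ α_{k+m-1}))` of `m` coefficients
starting at index `k`, using one multiplication per step. [cite: KnuthTAOCP2, §4.6.4 (16)] -/
def newtonHorner (v α : ℕ → F) (x : F) : ℕ → ℕ → F
  | _, 0 => 0
  | k, m + 1 => α k + (x - v k) * newtonHorner v α x (k + 1) m

/-- Closed form of the Horner tail:
`newtonHorner v α x k m = Σ_{j<m} α_{k+j} Π_{l<j} (x - x_{k+l})`.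
[cite: KnuthTAOCP2, §4.6.4 (16)] -/
theorem newtonHorner_eq_sum (v α : ℕ → F) (x : F) (m : ℕ) :
    ∀ k, newtonHorner v α x k m =
      ∑ j ∈ range m, α (k + j) * ∏ l ∈ range j, (x - v (k + l)) := by
  induction m with
  | zero => intro k; simp [newtonHorner]
  | succ m ih =>
    intro k
    rw [newtonHorner, ih (k + 1), sum_range_succ', prod_range_zero, mul_one, Nat.add_zero,
      add_comm, mul_sum]
    congr 1
    refine sum_congr rfl fun j _ => ?_
    rw [prod_range_succ', Nat.add_zero]
    have h1 : k + (j + 1) = k + 1 + j := by omega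
    have h2 : ∀ l ∈ range j, x - v (k + (l + 1)) = x - v (k + 1 + l) := fun l _ => by
      rw [show k + (l + 1) = k + 1 + l by omega]
    rw [h1, prod_congr rfl h2]
    ring

/-- SCHEME (16) IS CORRECT: running the generalized Horner rule on the divided differences
`α_0, …, α_n` computes `u^{[n]}(x)`, i.e. the value of the Newton sum (15), with `n + 1` steps.
[cite: KnuthTAOCP2, §4.6.4 (16)] -/
theorem newtonHorner_eq_eval (v r : ℕ → F) (n : ℕ) (x : F) :
    newtonHorner v (fun k => divDiff v r 0 k) x 0 (n + 1) = (newtonInterpolant v r n).eval x := by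
  rw [newtonHorner_eq_sum, newtonInterpolant_def, eval_finsetSum]
  refine sum_congr rfl fun j _ => ?_
  rw [eval_mul, eval_C, Lagrange.eval_nodal, Nat.zero_add]
  simp_rw [Nat.zero_add]

/-! ## The worked example of the text: interpolating factorials -/

section Example

/-- The text's example: the cubic through `(0, 0!), (1, 1!), (2, 2!), (3, 3!)` in Newton form,
`u^{[3]}(x) = (1/3) x(x-1)(x-2) + (1/2) x(x-1) + 0·x + 1` (divided differences `1, 0, 1/2, 1/3`).
[cite: KnuthTAOCP2, §4.6.4 example after (17)] -/
noncomputable def factorialCubic : ℚ[X] :=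
  C (1 / 3 : ℚ) * (X * (X - 1) * (X - 2)) + C (1 / 2 : ℚ) * (X * (X - 1)) + 1

/-- The cubic of the example takes the values `0! = 1`, `1! = 1`, `2! = 2`, `3! = 6` at
`x = 0, 1, 2, 3`. [cite: KnuthTAOCP2, §4.6.4 example after (17)] -/
theorem factorialCubic_values :
    factorialCubic.eval 0 = 1 ∧ factorialCubic.eval 1 = 1 ∧ factorialCubic.eval 2 = 2 ∧
      factorialCubic.eval 3 = 6 := by
  refine ⟨?_, ?_, ?_, ?_⟩ <;> norm_num [factorialCubic]

/-- … and the interpolated estimate of `(3/2)!` is `-1/8 + 3/8 + 1 = 1.25` (the text compares it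
with `Γ(5/2) ≈ 1.33`). [cite: KnuthTAOCP2, §4.6.4 example after (17)] -/
theorem factorialCubic_estimate : factorialCubic.eval (3 / 2 : ℚ) = 5 / 4 := by
  norm_num [factorialCubic]

/-- The example IS the Newton sum of the data (nodes `x_k = k`, values `y_k = k!`): by uniqueness
of the interpolating cubic, `factorialCubic = N_3`, so in particular its Newton coefficients
`1, 0, 1/2, 1/3` are the divided differences of `0!, 1!, 2!, 3!`.
[cite: KnuthTAOCP2, §4.6.4 (15), example after (17)] -/
theorem factorialCubic_eq_newtonInterpolant :
    factorialCubic = newtonInterpolant (fun k : ℕ => (k : ℚ)) (fun k => (k.factorial : ℚ)) 3 := by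
  refine eq_newtonInterpolant_of_eval_eq _ _ 3 (Nat.cast_injective.injOn) ?_ ?_
  · have : factorialCubic.degree ≤ 3 := by
      unfold factorialCubic; compute_degree!
    exact this.trans_lt (by exact_mod_cast Nat.lt_succ_self 3)
  · intro m hm
    interval_cases m <;> norm_num [factorialCubic, Nat.factorial]

end Example

end Literature.Algebra.Polynomial.NewtonInterpolation
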